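import Summits.HubbardSuperconductivity.HubbardSuperconductivity.Theorems.AnisotropyChordTransferFibre3L2ClosedTB096N00316C00000W01500
import Summits.HubbardSuperconductivity.HubbardSuperconductivity.Theorems.AnisotropyChordTransferFibre3L2ClosedTB096N00316C01500W02000
import Summits.HubbardSuperconductivity.HubbardSuperconductivity.Theorems.AnisotropyChordTransferFibre3L2BlockCover
import Summits.HubbardSuperconductivity.HubbardSuperconductivity.Theorems.AnisotropyChordTransferFibre3N1RowTCover

/-!
# Route `AnisotropyChord` / H0 rotor rung, LEVEL 2, t-BLOCK `96 ≤ L ≤ 127`: the GM₃ window is CLOSED on the `ν`-column `[316, 363]/10⁶` for `Δ ≤ 0.98`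

Block column assembly of the per-cell closures `L2.closedT_B096N00316C…W…` (2 cells tiling `a ∈ [0, 1/5]` ⊇ [0, 49·π²·ν₂] (the Δ ≤ 49/50 part),
glued by `closed_glue_a`): ★★ `closedDT_B096_colN00316` — for every `L ∈ [96, 127]` and every ground profile of the column the `∃ c a b` closure statement holds.
Prover seat `hubbard-h0-rotor-p1` g32 (route lead; ruling R4-b); helper for piece A = stmt-HubbardSuperconductivity-23918 of rung 19089
(`--supports`, helper class).  Nothing here proves superconductivity in the Hubbard model; one assembled column of ONE conditional reduction (the GM₃
∀L certificate on the t-blocks).  Mathlib + the tree only; no sorry.  Generated by p1 g32 scratch/blocks/mkcolT.py.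
-/

set_option linter.dupNamespace false
set_option autoImplicit false

namespace Summit.HubbardSuperconductivity.HubbardSuperconductivity.Theorems.AnisotropyChord.Transfer.Fibre3.L2

open L2.N1

/-- ★★ the closure statement on the block column `ν ∈ [316, 363]/10⁶` up to `a ≤ 1/5` (`≥ 49·π²·ν₂`). -/
theorem closedDT_B096_colN00316 (L : ℕ) [NeZero L] (hL : 96 ≤ L) (hL' : L ≤ 127) {Δ lam2 : ℝ} {f : Tor L → ℝ} (hΔ0 : 0 ≤ Δ) (hΔ1 : Δ < 1)
    (hf : IsGroundTwoMagnon L Δ lam2 f)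
    (hν1 : ((316 : ℝ) / 1000000) ≤ lam2 / (2 * Real.pi / L) ^ 2) (hν2 : lam2 / (2 * Real.pi / L) ^ 2 ≤ ((363 : ℝ) / 1000000))
    (ha1 : 0 ≤ Δ * f (K1 L)) (ha2 : Δ * f (K1 L) ≤ ((1 : ℝ) / 5)) :
    ∃ c a b : ℝ,
      (0 ≤ mHole L Δ f ∧ facMI L Δ f * etaEff L lam2 * (a + b / (2 + Real.cos (2 * Real.pi / L))) < c) ∧
      c * Uunit L Δ f ≤ trialGapN1 L Δ f ∧
      lowGForm L Δ f ≤ a * etaEff L lam2 * Uunit L Δ f ∧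
      (ip L (resid L Δ f) (resid L Δ f)).re - polePart L Δ f - lowNormPart L Δ f
        ≤ b * etaEff L lam2 * (2 * eps1 L - Tplus L Δ f) * Uunit L Δ f := by
  have ha0' : ((0 : ℝ) / 1) ≤ Δ * f (K1 L) := by simpa using ha1
  exact (fun h1 h2 => closed_glue_a L (m := ((3 : ℝ) / 20))
      (fun g1 g2 => closedT_B096N00316C00000W01500 L hL hL' hΔ0 hΔ1 hf hν1 hν2 g1 g2)
      (fun h1 h2 => closedT_B096N00316C01500W02000 L hL hL' hΔ0 hΔ1 hf hν1 hν2 h1 (le_trans h2 (by norm_num))) h1 h2) ha0' ha2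

end Summit.HubbardSuperconductivity.HubbardSuperconductivity.Theorems.AnisotropyChord.Transfer.Fibre3.L2
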